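import Mathlib.LinearAlgebra.Matrix.Notation
import Mathlib.LinearAlgebra.Matrix.Determinant.Basic
import Literature.NumberTheory.Automorphic.UnitaryGroupFormTransport
import HarnessLib

/-!
# Rank-3 isotropic unitary groups, I: the standard form, its unipotent radicals and the Weyl element

Topic `NumberTheory/Automorphic`; namespace `Literature.NumberTheory.Automorphic.UnitaryRankThree`.  KERNEL only
(theorems, no definition, no named fact, no `sorry`).

Setting ([Dieudonne1971GroupesClassiques, Chap. II §§4–5]; the rank-3, Witt-index-1 case of the structure theory
of unitary groups): `K` a field with `2 ≠ 0`, `σ : K →+* K` an involution (`σ ∘ σ = id`) admitting `θ₀ ≠ 0` with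
`σ θ₀ = −θ₀`, and `c ∈ K` with `σ c = c`, `c ≠ 0`.  In a Witt basis `(e, v, f)` (`e, f` isotropic, `h(e,f) = θ₀`,
`v ⟂ e, f`, `h(v,v) = c`) a non-degenerate ISOTROPIC `σ`-hermitian form of rank 3 has the STANDARD Gram matrix
`J₀ = !![0, 0, θ₀; 0, c, 0; -θ₀, 0, 0]` (hermitian: `σ(J₀)ᵀ = J₀`), and its unitary group is the tree's
`unitaryGroupOfForm σ J₀ = {g ∈ GL₃(K) ∣ σ(g)ᵀ J₀ g = J₀}` (`UnitaryGroupAutomorphicRep`; written out in full below —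
this file declares no notation and no definition).  For ANY homomorphism `χ : unitaryGroupOfForm σ J₀ →* A` to a
commutative group we prove:

* `apply_eq_one_of_val_eq_upper` — `χ` kills every UPPER unitriangular element `!![1, x, y; 0, 1, b; 0, 0, 1]` of the
  group (the unipotent radical `N` of the Borel subgroup fixing the isotropic line `K e`: each is a commutator with
  a torus element times a central one, and the central ones `!![1,0,r;0,1,0;0,0,1]`, `σ r = r`, are commutators);
* `apply_eq_one_of_val_eq_lower` — the same for the LOWER unitriangular elements (`N⁻ = w N w⁻¹`);
* `apply_eq_one_of_val_eq_weyl` — `χ` kills the Weyl element `w = !![0, 0, -1; 0, 1, 0; 1, 0, 0]`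
  (`w = E(−1) F(1) E(−1)` with `E`, `F` the long-root elements);
* the membership lemmas `upper_mem` (the parametrisation `x = c σ(b)/θ₀`, `θ₀ (σ y − y) = −c b σ(b)` of `N`) and
  `weyl_mem`.

Part II (`UnitaryRankThreeIsotropicCharacters`) adds the torus and the big cell and concludes that `χ` kills every
element of determinant `1` (`SU ≤ ker χ`), then transports to diagonal isotropic forms.

## References

* J. Dieudonné, *La géométrie des groupes classiques*, 3e éd., Springer (1971), Chap. II §§4–5
  [Dieudonne1971GroupesClassiques].
-/

set_option autoImplicit false

open Matrix

namespace Literature.NumberTheory.Automorphic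

namespace UnitaryRankThree

variable {K : Type*} [Field K] {σ : K →+* K} {θ₀ c : K} {A : Type*} [CommGroup A]

/-! ## §0 Plumbing: elements of `(unitaryGroupOfForm σ !![(0 : K), 0, θ₀; 0, c, 0; -θ₀, 0, 0])` from matrices; `χ` through matrices -/

/-- An invertible matrix satisfying the unitarity identity gives an element of `(unitaryGroupOfForm σ !![(0 : K), 0, θ₀; 0, c, 0; -θ₀, 0, 0])` with that matrix. [folklore] -/
private theorem exists_val_eq (M : Matrix (Fin 3) (Fin 3) K) (hd : M.det ≠ 0) (hm : (M.map σ)ᵀ * (!![(0 : K), 0, θ₀; 0, c, 0; -θ₀, 0, 0] : Matrix (Fin 3) (Fin 3) K) * M = (!![(0 : K), 0, θ₀; 0, c, 0; -θ₀, 0, 0] : Matrix (Fin 3) (Fin 3) K)) :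
    ∃ g : ↥(unitaryGroupOfForm σ !![(0 : K), 0, θ₀; 0, c, 0; -θ₀, 0, 0]), g.1.1 = M :=
  ⟨⟨Matrix.GeneralLinearGroup.mkOfDetNeZero M hd, hm⟩, rfl⟩

/-- The matrix of a product. [folklore] -/
private theorem val_mul (g h : ↥(unitaryGroupOfForm σ !![(0 : K), 0, θ₀; 0, c, 0; -θ₀, 0, 0])) : (g * h).1.1 = g.1.1 * h.1.1 := rfl

/-- The matrix of an inverse, from a left inverse. [folklore] -/
private theorem val_inv_eq {g : ↥(unitaryGroupOfForm σ !![(0 : K), 0, θ₀; 0, c, 0; -θ₀, 0, 0])} {M' : Matrix (Fin 3) (Fin 3) K} (h : M' * g.1.1 = 1) : (g⁻¹).1.1 = M' := by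
  have e : (g⁻¹).1.1 = g.1.1⁻¹ := by
    rw [Subgroup.coe_inv, Matrix.coe_units_inv]
  rw [e]
  exact Matrix.inv_eq_left_inv h

/-- The membership identity of an element of `(unitaryGroupOfForm σ !![(0 : K), 0, θ₀; 0, c, 0; -θ₀, 0, 0])`. [folklore] -/
private theorem val_mem (g : ↥(unitaryGroupOfForm σ !![(0 : K), 0, θ₀; 0, c, 0; -θ₀, 0, 0])) : (g.1.1.map σ)ᵀ * (!![(0 : K), 0, θ₀; 0, c, 0; -θ₀, 0, 0] : Matrix (Fin 3) (Fin 3) K) * g.1.1 = (!![(0 : K), 0, θ₀; 0, c, 0; -θ₀, 0, 0] : Matrix (Fin 3) (Fin 3) K) := g.2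

/-- Elements of `(unitaryGroupOfForm σ !![(0 : K), 0, θ₀; 0, c, 0; -θ₀, 0, 0])` with the same matrix are equal. [folklore] -/
private theorem ext_val {g h : ↥(unitaryGroupOfForm σ !![(0 : K), 0, θ₀; 0, c, 0; -θ₀, 0, 0])} (e : g.1.1 = h.1.1) : g = h := Subtype.ext (Units.ext e)

/-- `χ` is conjugation invariant. [folklore] -/
private theorem chi_conj (χ : ↥(unitaryGroupOfForm σ !![(0 : K), 0, θ₀; 0, c, 0; -θ₀, 0, 0]) →* A) (p g : ↥(unitaryGroupOfForm σ !![(0 : K), 0, θ₀; 0, c, 0; -θ₀, 0, 0])) : χ (p * g * p⁻¹) = χ g := by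
  rw [map_mul, map_mul, map_inv, mul_right_comm, mul_inv_cancel, one_mul]

/-- `χ` kills commutators. [folklore] -/
private theorem chi_comm (χ : ↥(unitaryGroupOfForm σ !![(0 : K), 0, θ₀; 0, c, 0; -θ₀, 0, 0]) →* A) (p g : ↥(unitaryGroupOfForm σ !![(0 : K), 0, θ₀; 0, c, 0; -θ₀, 0, 0])) : χ (p * g * p⁻¹ * g⁻¹) = 1 := by
  rw [map_mul, chi_conj, map_inv, mul_inv_cancel]

/-! ## §1 Matrix identities -/

/-- product of upper unitriangular matrices. [folklore] -/
private theorem upper_mul (x b y x' b' y' : K) :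
    (!![(1 : K), x, y; 0, 1, b; 0, 0, 1] : Matrix (Fin 3) (Fin 3) K) * (!![(1 : K), x', y'; 0, 1, b'; 0, 0, 1] : Matrix (Fin 3) (Fin 3) K) = (!![(1 : K), x + x', y' + x * b' + y; 0, 1, b + b'; 0, 0, 1] : Matrix (Fin 3) (Fin 3) K) := by
  ext i j
  fin_cases i <;> fin_cases j <;> simp [Matrix.mul_apply, Fin.sum_univ_three] <;> ring

/-- left inverse of an upper unitriangular matrix. [folklore] -/
private theorem upper_inv_mul (x b y : K) : (!![(1 : K), -x, x * b - y; 0, 1, -b; 0, 0, 1] : Matrix (Fin 3) (Fin 3) K) * (!![(1 : K), x, y; 0, 1, b; 0, 0, 1] : Matrix (Fin 3) (Fin 3) K) = 1 := by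
  ext i j
  fin_cases i <;> fin_cases j <;> simp [Matrix.mul_apply, Fin.sum_univ_three]
  ring

/-- an upper unitriangular matrix has determinant `1`. [folklore] -/
private theorem det_upper (x b y : K) : ((!![(1 : K), x, y; 0, 1, b; 0, 0, 1] : Matrix (Fin 3) (Fin 3) K)).det = 1 := by
  simp [Matrix.det_fin_three]

/-- a lower unitriangular matrix has determinant `1`. [folklore] -/
private theorem det_lower (b x y : K) : ((!![(1 : K), 0, 0; b, 1, 0; y, x, 1] : Matrix (Fin 3) (Fin 3) K)).det = 1 := by
  simp [Matrix.det_fin_three]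

/-- `det (!![(0 : K), 0, -1; 0, 1, 0; 1, 0, 0] : Matrix (Fin 3) (Fin 3) K) = 1`. [folklore] -/
private theorem det_weyl : (!![(0 : K), 0, -1; 0, 1, 0; 1, 0, 0] : Matrix (Fin 3) (Fin 3) K).det = 1 := by
  simp [Matrix.det_fin_three]

/-- `(!![(0 : K), 0, 1; 0, 1, 0; -1, 0, 0] : Matrix (Fin 3) (Fin 3) K) (!![(0 : K), 0, -1; 0, 1, 0; 1, 0, 0] : Matrix (Fin 3) (Fin 3) K) = 1`. [folklore] -/
private theorem weylInv_mul_weyl : (!![(0 : K), 0, 1; 0, 1, 0; -1, 0, 0] : Matrix (Fin 3) (Fin 3) K) * (!![(0 : K), 0, -1; 0, 1, 0; 1, 0, 0] : Matrix (Fin 3) (Fin 3) K) = (1 : Matrix (Fin 3) (Fin 3) K) := by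
  ext i j
  fin_cases i <;> fin_cases j <;> simp [Matrix.mul_apply, Fin.sum_univ_three]

/-- `(!![(0 : K), 0, -1; 0, 1, 0; 1, 0, 0] : Matrix (Fin 3) (Fin 3) K) (!![(0 : K), 0, 1; 0, 1, 0; -1, 0, 0] : Matrix (Fin 3) (Fin 3) K) = 1`. [folklore] -/
private theorem weyl_mul_weylInv : (!![(0 : K), 0, -1; 0, 1, 0; 1, 0, 0] : Matrix (Fin 3) (Fin 3) K) * (!![(0 : K), 0, 1; 0, 1, 0; -1, 0, 0] : Matrix (Fin 3) (Fin 3) K) = (1 : Matrix (Fin 3) (Fin 3) K) := by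
  ext i j
  fin_cases i <;> fin_cases j <;> simp [Matrix.mul_apply, Fin.sum_univ_three]

/-- `w (!![(1 : K), x, y; 0, 1, b; 0, 0, 1] : Matrix (Fin 3) (Fin 3) K) w⁻¹ = (!![(1 : K), 0, 0; -b, 1, 0; -y, x, 1] : Matrix (Fin 3) (Fin 3) K)`: the Weyl element swaps the two unipotent radicals. [folklore] -/
private theorem weyl_mul_upper_mul_weylInv (x b y : K) : (!![(0 : K), 0, -1; 0, 1, 0; 1, 0, 0] : Matrix (Fin 3) (Fin 3) K) * (!![(1 : K), x, y; 0, 1, b; 0, 0, 1] : Matrix (Fin 3) (Fin 3) K) * (!![(0 : K), 0, 1; 0, 1, 0; -1, 0, 0] : Matrix (Fin 3) (Fin 3) K) = (!![(1 : K), 0, 0; -b, 1, 0; -y, x, 1] : Matrix (Fin 3) (Fin 3) K) := by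
  ext i j
  fin_cases i <;> fin_cases j <;> simp [Matrix.mul_apply, Fin.sum_univ_three]

/-- `w⁻¹ (!![(1 : K), 0, 0; b, 1, 0; y, x, 1] : Matrix (Fin 3) (Fin 3) K) w = (!![(1 : K), x, -y; 0, 1, -b; 0, 0, 1] : Matrix (Fin 3) (Fin 3) K)`. [folklore] -/
private theorem weylInv_mul_lower_mul_weyl (b x y : K) : (!![(0 : K), 0, 1; 0, 1, 0; -1, 0, 0] : Matrix (Fin 3) (Fin 3) K) * (!![(1 : K), 0, 0; b, 1, 0; y, x, 1] : Matrix (Fin 3) (Fin 3) K) * (!![(0 : K), 0, -1; 0, 1, 0; 1, 0, 0] : Matrix (Fin 3) (Fin 3) K) = (!![(1 : K), x, -y; 0, 1, -b; 0, 0, 1] : Matrix (Fin 3) (Fin 3) K) := by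
  ext i j
  fin_cases i <;> fin_cases j <;> simp [Matrix.mul_apply, Fin.sum_univ_three]

/-- `w = E(-1) F(1) E(-1)` with `E(r) = (!![(1 : K), 0, r; 0, 1, 0; 0, 0, 1] : Matrix (Fin 3) (Fin 3) K)`, `F(r) = (!![(1 : K), 0, 0; 0, 1, 0; r, 0, 1] : Matrix (Fin 3) (Fin 3) K)`. [folklore] -/
private theorem weyl_eq : (!![(0 : K), 0, -1; 0, 1, 0; 1, 0, 0] : Matrix (Fin 3) (Fin 3) K) = (!![(1 : K), 0, -1; 0, 1, 0; 0, 0, 1] : Matrix (Fin 3) (Fin 3) K) * (!![(1 : K), 0, 0; 0, 1, 0; 1, 0, 1] : Matrix (Fin 3) (Fin 3) K) * (!![(1 : K), 0, -1; 0, 1, 0; 0, 0, 1] : Matrix (Fin 3) (Fin 3) K) := by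
  ext i j
  fin_cases i <;> fin_cases j <;> simp [Matrix.mul_apply, Fin.sum_univ_three]

/-- conjugating an upper unitriangular matrix by a diagonal one rescales its entries. [folklore] -/
private theorem diag_mul_upper_mul_diag (a u d x b y : K) (ha : a ≠ 0) (hu : u ≠ 0) (hd : d ≠ 0) :
    !![a, 0, 0; 0, u, 0; 0, 0, d] * (!![(1 : K), x, y; 0, 1, b; 0, 0, 1] : Matrix (Fin 3) (Fin 3) K) * !![a⁻¹, 0, 0; 0, u⁻¹, 0; 0, 0, d⁻¹] =
      (!![(1 : K), a * x * u⁻¹, a * y * d⁻¹; 0, 1, u * b * d⁻¹; 0, 0, 1] : Matrix (Fin 3) (Fin 3) K) := by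
  ext i j
  fin_cases i <;> fin_cases j <;> simp [Matrix.mul_apply, Fin.sum_univ_three, ha, hu, hd]

/-- left inverse of a diagonal matrix. [folklore] -/
private theorem diag_inv_mul (a u d : K) (ha : a ≠ 0) (hu : u ≠ 0) (hd : d ≠ 0) :
    !![a⁻¹, 0, 0; 0, u⁻¹, 0; 0, 0, d⁻¹] * !![a, 0, 0; 0, u, 0; 0, 0, d] = (1 : Matrix (Fin 3) (Fin 3) K) := by
  ext i j
  fin_cases i <;> fin_cases j <;> simp [Matrix.mul_apply, Fin.sum_univ_three, ha, hu, hd]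

/-- determinant of a diagonal matrix. [folklore] -/
private theorem det_diag (a u d : K) : (!![a, 0, 0; 0, u, 0; 0, 0, d] : Matrix (Fin 3) (Fin 3) K).det = a * u * d := by
  simp [Matrix.det_fin_three]

/-! ## §2 Membership: the torus, the unipotent radical, the Weyl element -/

/-- **The diagonal torus**: `diag(a, u, (σ a)⁻¹) ∈ (unitaryGroupOfForm σ !![(0 : K), 0, θ₀; 0, c, 0; -θ₀, 0, 0])` for `a ≠ 0` and `u σ(u) = 1`.
[cite: Dieudonne1971GroupesClassiques, Chap. II §4] -/
theorem diag_mem (hσ : ∀ x, σ (σ x) = x) (a u : K) (ha : a ≠ 0) (hu : u * σ u = 1) :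
    ((!![a, 0, 0; 0, u, 0; 0, 0, (σ a)⁻¹] : Matrix (Fin 3) (Fin 3) K).map σ)ᵀ * (!![(0 : K), 0, θ₀; 0, c, 0; -θ₀, 0, 0] : Matrix (Fin 3) (Fin 3) K) *
      !![a, 0, 0; 0, u, 0; 0, 0, (σ a)⁻¹] = (!![(0 : K), 0, θ₀; 0, c, 0; -θ₀, 0, 0] : Matrix (Fin 3) (Fin 3) K) := by
  have hσa : σ a ≠ 0 := fun h => ha (by simpa [hσ] using congrArg σ h)
  have hu' : σ u * u = 1 := by rw [mul_comm]; exact hu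
  ext i j
  fin_cases i <;> fin_cases j <;> simp [Matrix.mul_apply, Fin.sum_univ_three, hσ, map_inv₀]
  case «0».«2» => field_simp
  case «1».«1» => linear_combination c * hu'
  case «2».«0» => field_simp

/-- **The unipotent radical `N`** (stabiliser of the isotropic line `K e`): `(!![(1 : K), x, y; 0, 1, b; 0, 0, 1] : Matrix (Fin 3) (Fin 3) K) ∈ (unitaryGroupOfForm σ !![(0 : K), 0, θ₀; 0, c, 0; -θ₀, 0, 0])` as soon as
`x = c σ(b) / θ₀` and `θ₀ (σ y − y) = −c b σ(b)`. [cite: Dieudonne1971GroupesClassiques, Chap. II §4] -/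
theorem upper_mem (hσ : ∀ x, σ (σ x) = x) (hθ : σ θ₀ = -θ₀) (hθ0 : θ₀ ≠ 0) (hc : σ c = c) (x b y : K)
    (hx : x = c * σ b / θ₀) (hy : θ₀ * (σ y - y) = -(c * (b * σ b))) :
    (((!![(1 : K), x, y; 0, 1, b; 0, 0, 1] : Matrix (Fin 3) (Fin 3) K)).map σ)ᵀ * (!![(0 : K), 0, θ₀; 0, c, 0; -θ₀, 0, 0] : Matrix (Fin 3) (Fin 3) K) * (!![(1 : K), x, y; 0, 1, b; 0, 0, 1] : Matrix (Fin 3) (Fin 3) K) = (!![(0 : K), 0, θ₀; 0, c, 0; -θ₀, 0, 0] : Matrix (Fin 3) (Fin 3) K) := by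
  subst hx
  have hσθinv : σ θ₀⁻¹ = -θ₀⁻¹ := by rw [map_inv₀, hθ, neg_inv]
  ext i j
  fin_cases i <;> fin_cases j <;>
    simp [Matrix.mul_apply, Fin.sum_univ_three, hc, hσ, div_eq_mul_inv, hσθinv] <;> (try field_simp) <;>
    first | ring1 | linear_combination hy

/-- Conversely an upper unitriangular element of `(unitaryGroupOfForm σ !![(0 : K), 0, θ₀; 0, c, 0; -θ₀, 0, 0])` has `x = c σ(b)/θ₀` and `θ₀ (σ y − y) = −c b σ(b)`; in
particular for `b = 0`: `x = 0` and `σ y = y`. [cite: Dieudonne1971GroupesClassiques, Chap. II §4] -/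
theorem upper_shape (hσ : ∀ x, σ (σ x) = x) (hθ : σ θ₀ = -θ₀) (hθ0 : θ₀ ≠ 0) (hc : σ c = c) (x b y : K)
    (hm : (((!![(1 : K), x, y; 0, 1, b; 0, 0, 1] : Matrix (Fin 3) (Fin 3) K)).map σ)ᵀ * (!![(0 : K), 0, θ₀; 0, c, 0; -θ₀, 0, 0] : Matrix (Fin 3) (Fin 3) K) * (!![(1 : K), x, y; 0, 1, b; 0, 0, 1] : Matrix (Fin 3) (Fin 3) K) = (!![(0 : K), 0, θ₀; 0, c, 0; -θ₀, 0, 0] : Matrix (Fin 3) (Fin 3) K)) :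
    x = c * σ b / θ₀ ∧ θ₀ * (σ y - y) = -(c * (b * σ b)) := by
  have h12 := congrFun (congrFun hm 1) 2
  have h22 := congrFun (congrFun hm 2) 2
  simp [Matrix.mul_apply, Fin.sum_univ_three] at h12 h22
  constructor
  · -- from `σ x θ₀ + c b = 0`
    have hx : σ x = -(c * b) / θ₀ := by
      field_simp
      linear_combination h12
    have := congrArg σ hx
    rw [hσ, map_div₀, map_neg, map_mul, hθ, hc] at this
    rw [this]
    field_simp
  · linear_combination h22

/-- **The Weyl element** `w ∈ (unitaryGroupOfForm σ !![(0 : K), 0, θ₀; 0, c, 0; -θ₀, 0, 0])`. [cite: Dieudonne1971GroupesClassiques, Chap. II §4] -/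
theorem weyl_mem : ((!![(0 : K), 0, -1; 0, 1, 0; 1, 0, 0] : Matrix (Fin 3) (Fin 3) K).map σ)ᵀ * (!![(0 : K), 0, θ₀; 0, c, 0; -θ₀, 0, 0] : Matrix (Fin 3) (Fin 3) K) * (!![(0 : K), 0, -1; 0, 1, 0; 1, 0, 0] : Matrix (Fin 3) (Fin 3) K) = (!![(0 : K), 0, θ₀; 0, c, 0; -θ₀, 0, 0] : Matrix (Fin 3) (Fin 3) K) := by
  ext i j
  fin_cases i <;> fin_cases j <;> simp [Matrix.mul_apply, Fin.sum_univ_three]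

/-- The long-root elements `E(r) = (!![(1 : K), 0, r; 0, 1, 0; 0, 0, 1] : Matrix (Fin 3) (Fin 3) K)`, `σ r = r`, lie in `(unitaryGroupOfForm σ !![(0 : K), 0, θ₀; 0, c, 0; -θ₀, 0, 0])`. [cite: Dieudonne1971GroupesClassiques, Chap. II §4] -/
theorem upperCentral_mem (r : K) (hr : σ r = r) :
    (((!![(1 : K), 0, r; 0, 1, 0; 0, 0, 1] : Matrix (Fin 3) (Fin 3) K)).map σ)ᵀ * (!![(0 : K), 0, θ₀; 0, c, 0; -θ₀, 0, 0] : Matrix (Fin 3) (Fin 3) K) * (!![(1 : K), 0, r; 0, 1, 0; 0, 0, 1] : Matrix (Fin 3) (Fin 3) K) = (!![(0 : K), 0, θ₀; 0, c, 0; -θ₀, 0, 0] : Matrix (Fin 3) (Fin 3) K) := by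
  ext i j
  fin_cases i <;> fin_cases j <;> simp [Matrix.mul_apply, Fin.sum_univ_three, hr]
  ring

/-! ## §3 `χ` kills the unipotent radicals and the Weyl element -/

section Chi

variable (hσ : ∀ x, σ (σ x) = x) (hθ : σ θ₀ = -θ₀) (hθ0 : θ₀ ≠ 0) (hc : σ c = c) (h2 : (2 : K) ≠ 0)
include hσ hθ hθ0 h2

omit hθ0 in
/-- the auxiliary torus parameter `a = 1 + θ₀`: `a ≠ 0`, `σ a = 1 - θ₀ ≠ 0`, `a σ(a) − 1 = −θ₀² ≠ 0`. [folklore] -/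
private theorem aux_a :
    (1 + θ₀ : K) ≠ 0 ∧ σ (1 + θ₀) = 1 - θ₀ ∧ σ (1 + θ₀) ≠ 0 ∧ (1 + θ₀) * σ (1 + θ₀) - 1 = -θ₀ ^ 2 := by
  have hσa : σ (1 + θ₀) = 1 - θ₀ := by rw [map_add, map_one, hθ]; ring
  have ha0 : (1 + θ₀ : K) ≠ 0 := by
    intro h
    have h' : σ (1 + θ₀) = 0 := by rw [h, map_zero]
    rw [hσa] at h'
    exact h2 (by linear_combination h + h')
  refine ⟨ha0, hσa, fun h => ha0 (by simpa [hσ] using congrArg σ h), ?_⟩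
  rw [hσa]; ring

/-- **`χ` kills the long-root elements** `E(r) = (!![(1 : K), 0, r; 0, 1, 0; 0, 0, 1] : Matrix (Fin 3) (Fin 3) K)` (`σ r = r`): `E((aσa − 1) r') = [diag(a,1,σa⁻¹), E(r')]`.
[cite: Dieudonne1971GroupesClassiques, Chap. II §5] -/
theorem apply_eq_one_of_val_eq_upperCentral (χ : ↥(unitaryGroupOfForm σ !![(0 : K), 0, θ₀; 0, c, 0; -θ₀, 0, 0]) →* A) (g : ↥(unitaryGroupOfForm σ !![(0 : K), 0, θ₀; 0, c, 0; -θ₀, 0, 0])) (r : K) (hr : σ r = r)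
    (hg : g.1.1 = (!![(1 : K), 0, r; 0, 1, 0; 0, 0, 1] : Matrix (Fin 3) (Fin 3) K)) : χ g = 1 := by
  obtain ⟨ha0, hσa, hσa0, hN⟩ := aux_a hσ hθ h2
  set a : K := 1 + θ₀ with ha_def
  have hN0 : a * σ a - 1 ≠ 0 := by rw [hN]; exact neg_ne_zero.2 (pow_ne_zero 2 hθ0)
  obtain ⟨t, ht⟩ := exists_val_eq (σ := σ) (θ₀ := θ₀) (c := c) !![a, 0, 0; 0, 1, 0; 0, 0, (σ a)⁻¹]
    (by rw [det_diag]; exact mul_ne_zero (mul_ne_zero ha0 one_ne_zero) (inv_ne_zero hσa0))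
    (diag_mem hσ a 1 ha0 (by rw [map_one, mul_one]))
  set r' : K := r / (a * σ a - 1) with hr'_def
  have hr' : σ r' = r' := by
    rw [hr'_def, map_div₀, hr, map_sub, map_mul, hσ, map_one, mul_comm (σ a) a]
  obtain ⟨g', hg'⟩ := exists_val_eq (σ := σ) (θ₀ := θ₀) (c := c) (!![(1 : K), 0, r'; 0, 1, 0; 0, 0, 1] : Matrix (Fin 3) (Fin 3) K)
    (by rw [det_upper]; exact one_ne_zero) (upperCentral_mem r' hr')
  have hti : (t⁻¹).1.1 = !![a⁻¹, 0, 0; 0, 1, 0; 0, 0, σ a] := by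
    refine val_inv_eq ?_
    rw [ht]
    have := diag_inv_mul a 1 (σ a)⁻¹ ha0 one_ne_zero (inv_ne_zero hσa0)
    simpa only [inv_one, inv_inv] using this
  have hgi : (g'⁻¹).1.1 = (!![(1 : K), 0, -r'; 0, 1, 0; 0, 0, 1] : Matrix (Fin 3) (Fin 3) K) := by
    refine val_inv_eq ?_
    rw [hg']
    have := upper_inv_mul (K := K) 0 0 r'
    simpa using this
  have key : (t * g' * t⁻¹ * g'⁻¹).1.1 = g.1.1 := by
    rw [val_mul, val_mul, val_mul, ht, hg', hti, hgi, hg]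
    ext i j
    fin_cases i <;> fin_cases j <;> simp [Matrix.mul_apply, Fin.sum_univ_three, ha0, hσa0]
    rw [hr'_def]
    field_simp
    ring
  rw [← ext_val key]
  exact chi_comm χ t g'

include hc in
/-- **`χ` kills the unipotent radical `N`**: every upper unitriangular element of `(unitaryGroupOfForm σ !![(0 : K), 0, θ₀; 0, c, 0; -θ₀, 0, 0])`.
[cite: Dieudonne1971GroupesClassiques, Chap. II §5] -/
theorem apply_eq_one_of_val_eq_upper (χ : ↥(unitaryGroupOfForm σ !![(0 : K), 0, θ₀; 0, c, 0; -θ₀, 0, 0]) →* A) (g : ↥(unitaryGroupOfForm σ !![(0 : K), 0, θ₀; 0, c, 0; -θ₀, 0, 0])) (x b y : K) (hg : g.1.1 = (!![(1 : K), x, y; 0, 1, b; 0, 0, 1] : Matrix (Fin 3) (Fin 3) K)) :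
    χ g = 1 := by
  obtain ⟨ha0, hσa, hσa0, hN⟩ := aux_a hσ hθ h2
  set a : K := 1 + θ₀ with ha_def
  obtain ⟨t, ht⟩ := exists_val_eq (σ := σ) (θ₀ := θ₀) (c := c) !![a, 0, 0; 0, 1, 0; 0, 0, (σ a)⁻¹]
    (by rw [det_diag]; exact mul_ne_zero (mul_ne_zero ha0 one_ne_zero) (inv_ne_zero hσa0))
    (diag_mem hσ a 1 ha0 (by rw [map_one, mul_one]))
  have hti : (t⁻¹).1.1 = !![a⁻¹, 0, 0; 0, 1, 0; 0, 0, σ a] := by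
    refine val_inv_eq ?_
    rw [ht]
    have := diag_inv_mul a 1 (σ a)⁻¹ ha0 one_ne_zero (inv_ne_zero hσa0)
    simpa only [inv_one, inv_inv] using this
  -- the element `g' = n(b')` of `N` with middle entry `b' = -b/θ₀`
  set b' : K := -b / θ₀ with hb'_def
  set x' : K := c * σ b' / θ₀ with hx'_def
  set y' : K := c * (b' * σ b') / (2 * θ₀) with hy'_def
  have hσθinv : σ θ₀⁻¹ = -θ₀⁻¹ := by rw [map_inv₀, hθ, neg_inv]
  have hσ2 : σ (2 : K) = 2 := map_ofNat σ 2
  have hy' : θ₀ * (σ y' - y') = -(c * (b' * σ b')) := by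
    have : σ y' = -y' := by
      rw [hy'_def, map_div₀, map_mul, map_mul, hc, hσ, map_mul, hσ2, hθ]
      field_simp
    rw [this, hy'_def]
    field_simp
    ring
  obtain ⟨g', hg'⟩ := exists_val_eq (σ := σ) (θ₀ := θ₀) (c := c) (!![(1 : K), x', y'; 0, 1, b'; 0, 0, 1] : Matrix (Fin 3) (Fin 3) K)
    (by rw [det_upper]; exact one_ne_zero) (upper_mem hσ hθ hθ0 hc x' b' y' rfl hy')
  have hgi : (g'⁻¹).1.1 = (!![(1 : K), -x', x' * b' - y'; 0, 1, -b'; 0, 0, 1] : Matrix (Fin 3) (Fin 3) K) := val_inv_eq (by rw [hg']; exact upper_inv_mul x' b' y')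
  -- `g₂ := g' t g'⁻¹ t⁻¹ g` is upper unitriangular with middle entry `0`
  set X : K := x' - a * x' + x with hX
  set Y : K := y + (x' - a * x') * b + (a * σ a * (x' * b' - y') - x' * (σ a * b') + y') with hY
  have hval : (g' * t * g'⁻¹ * t⁻¹ * g).1.1 = (!![(1 : K), X, Y; 0, 1, 0; 0, 0, 1] : Matrix (Fin 3) (Fin 3) K) := by
    rw [val_mul, val_mul, val_mul, val_mul, hg', ht, hgi, hti, hg]
    have hbb : b' - σ a * b' + b = 0 := by rw [hσa, hb'_def]; field_simp; ring
    ext i j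
    fin_cases i <;> fin_cases j <;> simp [Matrix.mul_apply, Fin.sum_univ_three, ha0, hσa0]
    case «0».«1» => rw [hX]; ring
    case «0».«2» => rw [hY]; field_simp; ring
    case «1».«2» => field_simp; linear_combination hbb
  have hshape := upper_shape (c := c) hσ hθ hθ0 hc X 0 Y (by rw [← hval]; exact val_mem _)
  simp only [map_zero, mul_zero, zero_div, neg_zero] at hshape
  obtain ⟨hX0, hY0⟩ := hshape
  have hYfix : σ Y = Y := by
    have : σ Y - Y = 0 := by
      rcases mul_eq_zero.1 hY0 with h | h
      · exact absurd h hθ0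
      · exact h
    linear_combination this
  have h2' : χ (g' * t * g'⁻¹ * t⁻¹ * g) = 1 :=
    apply_eq_one_of_val_eq_upperCentral (c := c) hσ hθ hθ0 h2 χ _ Y hYfix (by rw [hval, hX0])
  have h1' : χ (t * g' * t⁻¹ * g'⁻¹) = 1 := chi_comm χ t g'
  have : g = (t * g' * t⁻¹ * g'⁻¹) * (g' * t * g'⁻¹ * t⁻¹ * g) := by group
  rw [this, map_mul, h1', h2', one_mul]

include hc in
/-- **`χ` kills the opposite unipotent radical `N⁻ = w N w⁻¹`**: every lower unitriangular element of `(unitaryGroupOfForm σ !![(0 : K), 0, θ₀; 0, c, 0; -θ₀, 0, 0])`.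
[cite: Dieudonne1971GroupesClassiques, Chap. II §5] -/
theorem apply_eq_one_of_val_eq_lower (χ : ↥(unitaryGroupOfForm σ !![(0 : K), 0, θ₀; 0, c, 0; -θ₀, 0, 0]) →* A) (g : ↥(unitaryGroupOfForm σ !![(0 : K), 0, θ₀; 0, c, 0; -θ₀, 0, 0])) (b x y : K) (hg : g.1.1 = (!![(1 : K), 0, 0; b, 1, 0; y, x, 1] : Matrix (Fin 3) (Fin 3) K)) :
    χ g = 1 := by
  obtain ⟨w, hw⟩ := exists_val_eq (σ := σ) (θ₀ := θ₀) (c := c) (!![(0 : K), 0, -1; 0, 1, 0; 1, 0, 0] : Matrix (Fin 3) (Fin 3) K) (by rw [det_weyl]; exact one_ne_zero) weyl_mem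
  have hwi : (w⁻¹).1.1 = (!![(0 : K), 0, 1; 0, 1, 0; -1, 0, 0] : Matrix (Fin 3) (Fin 3) K) := val_inv_eq (by rw [hw]; exact weylInv_mul_weyl)
  have hval : (w⁻¹ * g * w).1.1 = (!![(1 : K), x, -y; 0, 1, -b; 0, 0, 1] : Matrix (Fin 3) (Fin 3) K) := by
    rw [val_mul, val_mul, hwi, hg, hw]; exact weylInv_mul_lower_mul_weyl b x y
  have h1 := apply_eq_one_of_val_eq_upper (c := c) hσ hθ hθ0 hc h2 χ _ x (-b) (-y) hval
  have : g = w * (w⁻¹ * g * w) * w⁻¹ := by group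
  rw [this, chi_conj, h1]

include hc in
/-- **`χ` kills the Weyl element** `w = E(−1) F(1) E(−1)`. [cite: Dieudonne1971GroupesClassiques, Chap. II §5] -/
theorem apply_eq_one_of_val_eq_weyl (χ : ↥(unitaryGroupOfForm σ !![(0 : K), 0, θ₀; 0, c, 0; -θ₀, 0, 0]) →* A) (g : ↥(unitaryGroupOfForm σ !![(0 : K), 0, θ₀; 0, c, 0; -θ₀, 0, 0])) (hg : g.1.1 = (!![(0 : K), 0, -1; 0, 1, 0; 1, 0, 0] : Matrix (Fin 3) (Fin 3) K)) : χ g = 1 := by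
  obtain ⟨e₁, he₁⟩ := exists_val_eq (σ := σ) (θ₀ := θ₀) (c := c) (!![(1 : K), 0, -1; 0, 1, 0; 0, 0, 1] : Matrix (Fin 3) (Fin 3) K)
    (by rw [det_upper]; exact one_ne_zero) (upperCentral_mem (-1) (by rw [map_neg, map_one]))
  have hf₁mem : (((!![(1 : K), 0, 0; 0, 1, 0; (1 : K), 0, 1] : Matrix (Fin 3) (Fin 3) K)).map σ)ᵀ * (!![(0 : K), 0, θ₀; 0, c, 0; -θ₀, 0, 0] : Matrix (Fin 3) (Fin 3) K) * (!![(1 : K), 0, 0; 0, 1, 0; 1, 0, 1] : Matrix (Fin 3) (Fin 3) K) = (!![(0 : K), 0, θ₀; 0, c, 0; -θ₀, 0, 0] : Matrix (Fin 3) (Fin 3) K) := by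
    ext i j
    fin_cases i <;> fin_cases j <;> simp [Matrix.mul_apply, Fin.sum_univ_three]
  obtain ⟨f₁, hf₁⟩ := exists_val_eq (σ := σ) (θ₀ := θ₀) (c := c) (!![(1 : K), 0, 0; 0, 1, 0; 1, 0, 1] : Matrix (Fin 3) (Fin 3) K)
    (by rw [det_lower]; exact one_ne_zero) hf₁mem
  have hval : (e₁ * f₁ * e₁).1.1 = g.1.1 := by
    rw [val_mul, val_mul, he₁, hf₁, hg]; exact weyl_eq.symm
  rw [← ext_val hval, map_mul, map_mul,
    apply_eq_one_of_val_eq_upperCentral (c := c) hσ hθ hθ0 h2 χ e₁ (-1) (by rw [map_neg, map_one]) he₁,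
    apply_eq_one_of_val_eq_lower (c := c) hσ hθ hθ0 hc h2 χ f₁ 0 0 1 hf₁, one_mul, one_mul]

end Chi

end UnitaryRankThree

end Literature.NumberTheory.Automorphic
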